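import Summits.ResolutionOfSingularities.ResolutionOfSingularities.Theorems.WildQuotientsGaloisReduction
import Summits.ResolutionOfSingularities.ResolutionOfSingularities.Theorems.WildQuotientsGaloisQuotientAlterationOfPerfect
import HarnessLib

/-!
# `WildQuotients.GaloisReduction` (stmt-ResolutionOfSingularities-15641) from de Jong's theorem
# in the PAIR format over perfect fields

Route `ResolutionOfSingularities/WildQuotients`, support item `GaloisReduction`
(`:= WildQuotientResolution → Pialt`): de Jong's REDUCTION of the Abramovich–Oort purely
inseparable regular alteration (`Pialt`) to the resolution of Galois-type quotients `X′/G` of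
regular varieties (`WildQuotientResolution`) (de Jong 1997, Thm. 5.13 / Cor. 5.15).

The item is de Jong's theorem plus glue; all the glue is in tree. This file pins the closing
recipe to the CURRENT head statement of the line `FramePerfect` of the sibling crux
`SummitReduction` (stmt-ResolutionOfSingularities-16324), namely its theorem
`deJong1997_pair_perfect` (de Jong 1997, (5.12.1) for pairs `(X, G)`, `X` normal projective over a
PERFECT field, with an equivariant strict-normal-crossings boundary):

* `galoisReduction_of_deJong1997PairPerfect : (pair statement) → GaloisReduction` — the
  composition of `galoisQuotientAlteration_of_deJong1997PairPerfect`
  (`…WildQuotientsGaloisQuotientAlterationOfPerfect`: trivial pair `(X, {1})`, `Z = ∅`, descent from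
  the perfect closure, Chow, quotient by the finite group) with
  `galoisReduction_of_galoisQuotientAlteration` (`…WildQuotientsGaloisReduction`: resolve the
  quotient by `WildQuotientResolution`, compose with the radicial `φ`).

When that line closes (its head theorem lands sorry-free under `Theorems/`), the item closes by
`galoisReduction_of_deJong1997PairPerfect deJong1997_pair_perfect`. Sibling closing recipes already
in tree: `galoisReduction_of_deJong1997` (named fact
`Literature.AlgebraicGeometry.Resolution.DeJong1997_galoisAlterationQuasiProjective`) and
`galoisReduction_of_forall_perfectField_galoisAlteration{,Projective}` (datum format).

The theorem is proved; it is conditional only through its explicit hypothesis.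
-/

-- single-problem summit: the doubled namespace component `ResolutionOfSingularities` is forced
set_option linter.dupNamespace false

noncomputable section

open CategoryTheory AlgebraicGeometry

namespace Summit.ResolutionOfSingularities.ResolutionOfSingularities.Theorems

open Literature.AlgebraicGeometry.Resolution Literature.AlgebraicGeometry
open Literature.AlgebraicGeometry.Motives (RatFn.functionFieldMap)

/-- **`GaloisReduction` (stmt-ResolutionOfSingularities-15641) from de Jong's equivariant
alteration theorem in the PAIR format over PERFECT fields.** If for every prime `p`, every perfect
field `k` of characteristic `p`, every normal integral projective `k`-variety `X` with an action of
a finite group `G` over `k` and every proper `G`-stable closed subset `Z ⊂ X` there is a pair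
`(X₁, G₁)` — `X₁` regular integral projective, `G₁ ↠ G`, an equivariant alteration `π₁ : X₁ → X`
with `K(X₁)^{G₁}` purely inseparable over `π₁♯ K(X)^G`, and a `G₁`-strict normal crossings divisor
`D₁ ⊇ π₁⁻¹ Z` (de Jong 1997, (5.12.1) via Thm. 5.13 + Cor. 5.15; de Jong 1996, Thm. 7.3) — then
`WildQuotientResolution → Pialt`: the Galois-type quotient presentation of every variety over every
field of characteristic `p` follows (`galoisQuotientAlteration_of_deJong1997PairPerfect`: trivial
pair, empty boundary, descent from the perfect closure, quotient by the group), the quotient is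
resolved by `WildQuotientResolution`, and the resolution composed with the radicial map to `X` is
the required purely inseparable regular alteration (`galoisReduction_of_galoisQuotientAlteration`).
The hypothesis is verbatim the statement `deJong1997_pair_perfect` of the line `FramePerfect` of the
crux `SummitReduction` (stmt-ResolutionOfSingularities-16324).
[cite: DeJong1997, (5.12.1), Thm. 5.13 and Cor. 5.15, pp. 619–620] [cite: DeJong1996, Thm. 7.3, p. 88] -/
theorem galoisReduction_of_deJong1997PairPerfect
    (HP : ∀ (p : ℕ), p.Prime → ∀ (k : Type) [Field k] [CharP k p] [PerfectField k]
      (X : Scheme.{0}) [IsIntegral X] (f : X ⟶ Spec (.of k)),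
      IsSeparated f → LocallyOfFiniteType f → QuasiCompact f →
      (∀ x : X, IsIntegrallyClosed (X.presheaf.stalk x)) →
      Motives.IsProjectiveOver (Over.mk f) →
      ∀ (G : Type) [Group G] [Finite G] (ρ : G →* Aut X), (∀ g : G, (ρ g).hom ≫ f = f) →
      ∀ (Z : Set X), IsClosed Z → Z ≠ Set.univ → (∀ g : G, (ρ g).hom.base '' Z ⊆ Z) →
      ∃ (G₁ : Type) (_ : Group G₁) (_ : Finite G₁) (X₁ : Scheme.{0}) (_ : IsIntegral X₁)
        (ρ₁ : G₁ →* Aut X₁) (φ₁ : G₁ →* G) (π₁ : X₁ ⟶ X) (_ : IsDominant π₁),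
        Function.Surjective φ₁ ∧ IsAlteration π₁ ∧ Scheme.IsRegular X₁ ∧
        Motives.IsProjectiveOver (Over.mk (π₁ ≫ f)) ∧
        (∀ g : G₁, (ρ₁ g).hom ≫ π₁ = π₁ ≫ (ρ (φ₁ g)).hom) ∧
        (∀ a : X₁.functionField, (∀ g : G₁, RatFn.functionFieldMap (ρ₁ g).hom a = a) →
          ∃ (n : ℕ) (c : X.functionField), (∀ g : G, RatFn.functionFieldMap (ρ g).hom c = c) ∧
            a ^ ringExpChar X.functionField ^ n = RatFn.functionFieldMap π₁ c) ∧
        ∃ D₁ : Set X₁, IsStrictNormalCrossingsDivisor X₁ D₁ ∧ π₁.base ⁻¹' Z ⊆ D₁ ∧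
          (∀ g : G₁, (ρ₁ g).hom.base '' D₁ = D₁) ∧
          (∀ (g : G₁) (C : Set X₁), Maximal (fun C : Set X₁ => IsIrreducible C ∧ C ⊆ D₁) C →
            (C ∩ (ρ₁ g).hom.base '' C).Nonempty → (ρ₁ g).hom.base '' C = C)) :
    Theses.WildQuotients.GaloisReduction :=
  galoisReduction_of_galoisQuotientAlteration (galoisQuotientAlteration_of_deJong1997PairPerfect HP)

end Summit.ResolutionOfSingularities.ResolutionOfSingularities.Theorems

end
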